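import Summits.BirchSwinnertonDyer.BirchSwinnertonDyer.Theorems.Rank2ObservatoryPadicAtlasR2A10
import Summits.BirchSwinnertonDyer.BirchSwinnertonDyer.Theorems.Rank2ObservatoryRank2Rows00Complete
import HarnessLib

/-!
# BirchSwinnertonDyer — rank ≥ 2 observatory: `p`-adic atlas of the rank-2 census — UNCONDITIONAL RANK
# for part 10 (the census rank certificate `hlow` discharged in-tree)

HONEST FRAMING: per-curve certified theorems and census instruments; no claim on BSD in rank ≥ 2.

Companion of `Rank2ObservatoryPadicAtlasR2ARank.lean` (parts 00–09 and 11) for the data part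
`Rank2ObservatoryPadicAtlasR2A10` (42 curves of the rank-2 census, conductor `3994 ≤ N ≤ 4448`, their
two-engine cells `(E, p)`, `p ∈ {5, 7, 11, 13}` good ordinary), which states its consequence
`padicRow_of_mem_atlasR2A10` under the census rank certificate `hlow : 2 ≤ rank_ℤ E(ℚ)` as a NAMED
HYPOTHESIS. This file discharges it: the rows of the part are rows of the census chunk `rank2Rows00`
VERBATIM — ONE kernel `decide` of the sublist relation `(atlasR2A10.map AtlasCurve.row) <+ rank2Rows00`
(derived `DecidableEq Rank2Row`; census order) — and `Rank2ObservatoryRank2Rows00Complete.lean` proves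
`2 ≤ rank_ℤ E(ℚ)` for EVERY row of that chunk with no hypothesis (kernel certificates of two independent
listed points + Mordell–Weil in the tree). Consequence `padicRowU_of_mem_atlasR2A10`: for every listed
cell `(E, p)`, GIVEN ONLY the named analytic inputs of the series — `hPRS` (Perrin-Riou–Schneider, BMS
Thm. 1.7), `hkato` (Kato, Thm. 17.4, all cyclotomic data), the newform `hf` — and the symbol DATA
`hint`/`htab` (two-engine tables, `data/padic/symtab/` of the cell folder): `rank_ℤ E(ℚ) = 2` EXACTLY,
`ord_{T=0} L_p(E,T) = 2`, `Ш(E/ℚ)[p^∞]` finite, every canonical `p`-adic height pairing on `E` is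
non-degenerate (Schneider's conjecture at `(E, p)`), and `corank_{ℤ_p} Sel_{p^∞}(E/ℚ) = 2`.
No `sorry`, no new axioms, kernel `decide` only (no `native_decide`).

References: B. Mazur, J. Tate, J. Teitelbaum, Invent. Math. 84 (1986), §I.10–I.13; J. Balakrishnan,
J. S. Müller, W. Stein, Math. Comp. 85 (2016), Thm. 1.7; K. Kato, Astérisque 295 (2004), Thm. 17.4;
P. Schneider, Invent. Math. 79 (1985); J. Cremona, Algorithms for Modular Elliptic Curves (1997), Table 1,
§3.5; J. Silverman, AEC (2009), VIII.6.7.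
-/

-- single-conjunct summit: `Summit.BirchSwinnertonDyer.BirchSwinnertonDyer.…` repeats the name by design
set_option linter.dupNamespace false

namespace Summit.BirchSwinnertonDyer.BirchSwinnertonDyer.Rank2Observatory

open scoped MatrixGroups ModularForm
open CongruenceSubgroup Literature.NumberTheory.EllipticCurves
  Literature.NumberTheory.EllipticCurves.ModularForms WeierstrassCurve

/-- `42` curves in part 10. [folklore] -/
theorem atlasR2A10_length : atlasR2A10.length = 42 := by decide +kernel

/-- The rows of part 10 form a sublist of the census chunk `rank2Rows00` (ONE kernel `decide`, derived
`DecidableEq Rank2Row`): the atlas rows ARE census rows, verbatim and in census order.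
[cite: CremonaAlgorithms1997, Table 1] -/
theorem atlasR2A10_sublist : (atlasR2A10.map AtlasCurve.row).Sublist rank2Rows00 := by
  decide +kernel

/-- Every row of part 10 is a row of the census chunk `rank2Rows00`. [folklore] -/
theorem row_mem_rank2Rows00_of_mem_atlasR2A10 {C : AtlasCurve} (hC : C ∈ atlasR2A10) :
    C.row ∈ rank2Rows00 :=
  atlasR2A10_sublist.subset (List.mem_map_of_mem hC)

/-- Every row of part 10 is a row of the census table `rank2Table`.
[cite: CremonaAlgorithms1997, Table 1] -/
theorem row_mem_rank2Table_of_mem_atlasR2A10 {C : AtlasCurve} (hC : C ∈ atlasR2A10) :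
    C.row ∈ rank2Table :=
  mem_rank2Table_of_mem_rank2Rows00 (row_mem_rank2Rows00_of_mem_atlasR2A10 hC)

/-- **`2 ≤ rank_ℤ E(ℚ)` for every curve of part 10, with NO hypothesis** (chunk completeness
`two_le_mordellWeilRank_of_mem_rank2Rows00`). [cite: CremonaAlgorithms1997, §3.5]
[cite: SilvermanAEC2009, Thm. VIII.6.7] -/
theorem two_le_rank_of_mem_atlasR2A10 {C : AtlasCurve} (hC : C ∈ atlasR2A10) :
    2 ≤ C.row.curve.mordellWeilRank :=
  two_le_mordellWeilRank_of_mem_rank2Rows00 (row_mem_rank2Rows00_of_mem_atlasR2A10 hC)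

/-- **The `p`-adic row of every cell of part 10 with the rank input PROVED** (`AtlasCurve.padicRow`
with `hlow := two_le_rank_of_mem_atlasR2A10 hC`; instances from `isElliptic_of_mem_atlasR2A10`,
`isGloballyMinimal_of_mem_atlasR2A10`, `prime_of_mem_atlasR2A10` of the data part): GIVEN `hPRS`,
`hkato`, the newform `hf` and the symbol DATA `hint`/`htab` only, `rank = 2`, `ord_{T=0} L_p = 2`,
`Ш[p^∞]` finite, Schneider non-degeneracy at `p`, `corank Sel_{p^∞} = 2`.
[cite: BalakrishnanMullerStein2015, Thm. 1.7] [cite: Kato2004Asterisque, Thm. 17.4 (p. 273)]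
[cite: MazurTateTeitelbaum1986Invent, §I.10–I.13] -/
theorem padicRowU_of_mem_atlasR2A10 {C : AtlasCurve} (hC : C ∈ atlasR2A10) {c : AtlasCell}
    (hc : c ∈ C.cells) [Fact c.p.Prime] [(C.e.baseChange ℚ).IsElliptic]
    [(C.e.baseChange ℚ).IsGloballyMinimal] (hPRS : Schneider1985_order_charGenerator) {N : ℕ}
    [NeZero N] {f : CuspForm (Gamma0 N) 2} (hf : IsNewformOf (C.e.baseChange ℚ) f)
    (hkato : ∀ (κ : ZpExtension ℚ c.p) (γ : Field.absoluteGaloisGroup ℚ),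
      kato_divisibility (C.e.baseChange ℚ) c.p (κ := κ) (γ := γ) (f := f))
    (D : ℚ) (hD : ‖(D : ℚ_[c.p])‖ = 1) (hint : ∀ x : ℚ, ‖(ratPlusSymbol f x : ℚ_[c.p])‖ ≤ 1)
    (htab : ∀ u : ℕ, u < c.p ^ (c.n + 1) → ¬ c.p ∣ u →
      ratPlusSymbol f ((u : ℚ) / (c.p : ℚ) ^ (c.n + 1)) = (c.tabHi.getD u 0 : ℚ) / D ∧
      ratPlusSymbol f ((u : ℚ) / (c.p : ℚ) ^ c.n) = (c.tabLo.getD (u % c.p ^ c.n) 0 : ℚ) / D) :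
    C.row.curve.mordellWeilRank = 2 ∧
      (padicLFunction f (unitRoot (C.e.baseChange ℚ) c.p : ℚ_[c.p])).order = 2 ∧
      Finite (AddCommGroup.primaryComponent (C.e.baseChange ℚ).sha c.p) ∧
      (∀ Dh : PAdicHeightData (C.e.baseChange ℚ) c.p, Dh.IsCanonical → SchneiderConjecture Dh) ∧
      (C.e.baseChange ℚ).selmerCorank c.p = 2 :=
  AtlasCurve.padicRow (AtlasCurve.check_of_all atlasR2A10_check hC).1 hc hPRS hf hkato
    (two_le_rank_of_mem_atlasR2A10 hC) D hD hint htab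

end Summit.BirchSwinnertonDyer.BirchSwinnertonDyer.Rank2Observatory
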